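import Summits.QuantumFields.YangMills.Theorems.IR.SCFloorTorusLeading

/-!
# Strong-coupling floor engine, part 7: the lateral Mayer term to order `b⁴`

Pooled prover `ym-ir-line-bsf-p1` (crux `IR`, stmt-QuantumFields-19354; director-ym R366 pooled queue), support file for
`FacingPlaquetteCovFloor`.  With `φ` continuous, central, symmetric, `∫ φ = 0`, and the plaquette cost written as
`N − Re tr ρ(h) = κ₀ − φ(h)`, the Mayer term of the four LATERAL plaquettes
`T(b) = ∫ Δφ(hol_{P₀}) Δφ(hol_{P₁}) ∏ₖ (e^{−b·dTerm_{ℓₖ}} − 1) dπ` satisfies `|T(b) − 2 φ^{*6}(1) b⁴| ≤ K |b|⁵` for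
`|b| ≤ b₁` (`lateral_term_estimate`):  `e^{−b·dTerm} − 1 = e^{−2bκ₀}(e^{b s} − 1) + (e^{−2bκ₀} − 1)` with
`s = φ(hol U) + φ(hol U')`; every proper sub-product vanishes by peeling an uncovered bottom bond of `P₀` (part 6), so
`T(b) = e^{−8bκ₀} ∫ ΔΔ ∏ₖ (e^{b sₖ} − 1)`; and `∏ₖ (e^{b sₖ} − 1) = b⁴ ∏ₖ sₖ + O(b⁵)` with `∫ ΔΔ ∏ₖ sₖ = 2 φ^{*6}(1)`
(part 6).  Group-blind strong-coupling combinatorics; nothing here bears on the Yang–Mills mass gap.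
-/

set_option autoImplicit false

noncomputable section

open MeasureTheory Filter Topology Function Finset
open Literature.MathematicalPhysics.QuantumFieldTheory
open Literature.MathematicalPhysics.QuantumLattice (haarConv)

namespace Summit.QuantumFields.YangMills.Cruxes.IR.SCFloor

open BetaSlopeFloor (dTerm measurable_dTerm exists_bound_plaquetteCost measurable_inl_copy measurable_inr_copy)

/-- Four-term product perturbation: `|∏ aₖ − ∏ cₖ| ≤ 4 A³ δ` when `|aₖ|, |cₖ| ≤ A` and `|aₖ − cₖ| ≤ δ`. -/
theorem abs_prod_four_sub_prod_le {a c : Fin 4 → ℝ} {A δ : ℝ} (hA : 0 ≤ A) (ha : ∀ k, |a k| ≤ A)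
    (hc : ∀ k, |c k| ≤ A) (hd : ∀ k, |a k - c k| ≤ δ) :
    |∏ k, a k - ∏ k, c k| ≤ 4 * A ^ 3 * δ := by
  have hδ : 0 ≤ δ := (abs_nonneg _).trans (hd 0)
  rw [Fin.prod_univ_four, Fin.prod_univ_four]
  have key : a 0 * a 1 * a 2 * a 3 - c 0 * c 1 * c 2 * c 3 =
      (a 0 - c 0) * a 1 * a 2 * a 3 + c 0 * (a 1 - c 1) * a 2 * a 3 + c 0 * c 1 * (a 2 - c 2) * a 3 +
        c 0 * c 1 * c 2 * (a 3 - c 3) := by ring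
  rw [key]
  have t1 : |(a 0 - c 0) * a 1 * a 2 * a 3| ≤ δ * A * A * A := by
    rw [abs_mul, abs_mul, abs_mul]
    exact mul_le_mul (mul_le_mul (mul_le_mul (hd 0) (ha 1) (abs_nonneg _) hδ) (ha 2) (abs_nonneg _)
      (by positivity)) (ha 3) (abs_nonneg _) (by positivity)
  have t2 : |c 0 * (a 1 - c 1) * a 2 * a 3| ≤ A * δ * A * A := by
    rw [abs_mul, abs_mul, abs_mul]
    exact mul_le_mul (mul_le_mul (mul_le_mul (hc 0) (hd 1) (abs_nonneg _) hA) (ha 2) (abs_nonneg _)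
      (by positivity)) (ha 3) (abs_nonneg _) (by positivity)
  have t3 : |c 0 * c 1 * (a 2 - c 2) * a 3| ≤ A * A * δ * A := by
    rw [abs_mul, abs_mul, abs_mul]
    exact mul_le_mul (mul_le_mul (mul_le_mul (hc 0) (hc 1) (abs_nonneg _) hA) (hd 2) (abs_nonneg _)
      (by positivity)) (ha 3) (abs_nonneg _) (by positivity)
  have t4 : |c 0 * c 1 * c 2 * (a 3 - c 3)| ≤ A * A * A * δ := by
    rw [abs_mul, abs_mul, abs_mul]
    exact mul_le_mul (mul_le_mul (mul_le_mul (hc 0) (hc 1) (abs_nonneg _) hA) (hc 2) (abs_nonneg _)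
      (by positivity)) (hd 3) (abs_nonneg _) (by positivity)
  calc _ ≤ |(a 0 - c 0) * a 1 * a 2 * a 3| + |c 0 * (a 1 - c 1) * a 2 * a 3| + |c 0 * c 1 * (a 2 - c 2) * a 3| +
        |c 0 * c 1 * c 2 * (a 3 - c 3)| := by
        refine (abs_add_le _ _).trans (add_le_add ((abs_add_le _ _).trans (add_le_add (abs_add_le _ _) le_rfl)) le_rfl)
    _ ≤ δ * A * A * A + A * δ * A * A + A * A * δ * A + A * A * A * δ := by linarith
    _ = 4 * A ^ 3 * δ := by ring

variable {L : ℕ} [NeZero L] [Fact (1 < L)] {G : Type*} [Group G] [TopologicalSpace G] [IsTopologicalGroup G]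
  [CompactSpace G] [MeasurableSpace G] [BorelSpace G] [SecondCountableTopology G] [T2Space G]
  {N : ℕ} (ρ : G →* Matrix (Fin N) (Fin N) ℂ)

/-- **The lateral Mayer term to order `b⁴`.**  `|T(b) − 2 φ^{*6}(1) b⁴| ≤ K |b|⁵` for `|b| ≤ b₁`, where
`T(b) = ∫ Δφ(hol_{P₀}) Δφ(hol_{P₁}) ∏ₖ (e^{−b·dTerm_{ℓₖ}} − 1) dπ` over the four lateral plaquettes. -/
theorem lateral_term_estimate (hL : 3 ≤ L) {φ : G → ℝ} (hφc : Continuous φ)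
    (hφz : ∀ g h, φ (h * g * h⁻¹) = φ g) (hφs : ∀ g, φ g⁻¹ = φ g) (hφ0 : ∫ g, φ g ∂haarProbability G = 0)
    {κ₀ : ℝ} (hcost : ∀ h : G, (N : ℝ) - (ρ h).trace.re = κ₀ - φ h) :
    ∃ K b₁ : ℝ, 0 < b₁ ∧ ∀ b : ℝ, |b| ≤ b₁ →
      |(∫ W, (φ (plaquetteHolonomy (fun a => W (Sum.inl a)) 0 1 2) - φ (plaquetteHolonomy (fun a => W (Sum.inr a)) 0 1 2)) *
          (φ (plaquetteHolonomy (fun a => W (Sum.inl a)) ((0 : Site 4 L).shift 0) 1 2) -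
            φ (plaquetteHolonomy (fun a => W (Sum.inr a)) ((0 : Site 4 L).shift 0) 1 2)) *
          ∏ k : Fin 4, (Real.exp (-(b * dTerm ρ ((![((0 : Site 4 L), ⟨((0 : Fin 4), (1 : Fin 4)), by decide⟩), ((0 : Site 4 L).shift 2, ⟨((0 : Fin 4), (1 : Fin 4)), by decide⟩),
        ((0 : Site 4 L), ⟨((0 : Fin 4), (2 : Fin 4)), by decide⟩), ((0 : Site 4 L).shift 1, ⟨((0 : Fin 4), (2 : Fin 4)), by decide⟩)] :
        Fin 4 → Plaquette 4 L) k) W)) - 1)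
        ∂(Measure.pi fun _ : Edge 4 L ⊕ Edge 4 L => haarProbability G)) -
        2 * ((haarConv φ)^[5] φ) 1 * b ^ 4| ≤ K * |b| ^ 5 := by
  classical
  set μ₂ : Measure (Edge 4 L ⊕ Edge 4 L → G) := Measure.pi fun _ => haarProbability G with hμ₂
  haveI : IsProbabilityMeasure μ₂ := by rw [hμ₂]; infer_instance
  set lat : Fin 4 → Plaquette 4 L := (![((0 : Site 4 L), ⟨((0 : Fin 4), (1 : Fin 4)), by decide⟩), ((0 : Site 4 L).shift 2, ⟨((0 : Fin 4), (1 : Fin 4)), by decide⟩),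
        ((0 : Site 4 L), ⟨((0 : Fin 4), (2 : Fin 4)), by decide⟩), ((0 : Site 4 L).shift 1, ⟨((0 : Fin 4), (2 : Fin 4)), by decide⟩)] :
        Fin 4 → Plaquette 4 L) with hlat
  set J : ℝ := ((haarConv φ)^[5] φ) 1 with hJ
  -- face functions
  set X : (Edge 4 L ⊕ Edge 4 L → G) → ℝ := fun W => φ (plaquetteHolonomy (fun a => W (Sum.inl a)) 0 1 2) with hX
  set X' : (Edge 4 L ⊕ Edge 4 L → G) → ℝ := fun W => φ (plaquetteHolonomy (fun a => W (Sum.inr a)) 0 1 2) with hX'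
  set Y : (Edge 4 L ⊕ Edge 4 L → G) → ℝ := fun W =>
    φ (plaquetteHolonomy (fun a => W (Sum.inl a)) ((0 : Site 4 L).shift 0) 1 2) with hY
  set Y' : (Edge 4 L ⊕ Edge 4 L → G) → ℝ := fun W =>
    φ (plaquetteHolonomy (fun a => W (Sum.inr a)) ((0 : Site 4 L).shift 0) 1 2) with hY'
  set t : Fin 4 → (Edge 4 L ⊕ Edge 4 L → G) → ℝ := fun k W =>
    φ (plaquetteHolonomy (fun a => W (Sum.inl a)) (lat k).1 (lat k).2.1.1 (lat k).2.1.2) with ht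
  set t' : Fin 4 → (Edge 4 L ⊕ Edge 4 L → G) → ℝ := fun k W =>
    φ (plaquetteHolonomy (fun a => W (Sum.inr a)) (lat k).1 (lat k).2.1.1 (lat k).2.1.2) with ht'
  -- bounds
  have hφm : Measurable φ := hφc.measurable
  obtain ⟨Cφ, hCφ⟩ := isCompact_univ.exists_bound_of_continuousOn hφc.continuousOn
  have hCφ' : ∀ g, |φ g| ≤ Cφ := fun g => Real.norm_eq_abs _ ▸ hCφ g (Set.mem_univ g)
  have hC0 : 0 ≤ Cφ := (abs_nonneg _).trans (hCφ' 1)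
  set σ : ℝ := 2 * Cφ with hσ
  have hσ0 : 0 ≤ σ := by positivity
  have hholl : ∀ (x : Site 4 L) (i j : Fin 4), Measurable fun W : Edge 4 L ⊕ Edge 4 L → G =>
      φ (plaquetteHolonomy (fun a => W (Sum.inl a)) x i j) :=
    fun x i j => hφm.comp ((measurable_plaquetteHolonomy x i j).comp measurable_inl_copy)
  have hholr : ∀ (x : Site 4 L) (i j : Fin 4), Measurable fun W : Edge 4 L ⊕ Edge 4 L → G =>
      φ (plaquetteHolonomy (fun a => W (Sum.inr a)) x i j) :=
    fun x i j => hφm.comp ((measurable_plaquetteHolonomy x i j).comp measurable_inr_copy)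
  have hXm : Measurable X := hholl 0 1 2
  have hX'm : Measurable X' := hholr 0 1 2
  have hYm : Measurable Y := hholl _ 1 2
  have hY'm : Measurable Y' := hholr _ 1 2
  have htm : ∀ k, Measurable (t k) := fun k => hholl _ _ _
  have ht'm : ∀ k, Measurable (t' k) := fun k => hholr _ _ _
  have hXb : ∀ W, |X W| ≤ Cφ := fun W => hCφ' _
  have hX'b : ∀ W, |X' W| ≤ Cφ := fun W => hCφ' _
  have hYb : ∀ W, |Y W| ≤ Cφ := fun W => hCφ' _
  have hY'b : ∀ W, |Y' W| ≤ Cφ := fun W => hCφ' _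
  have hsb : ∀ k W, |t k W + t' k W| ≤ σ := fun k W => (abs_add_le _ _).trans (by
    rw [hσ]; linarith [hCφ' (plaquetteHolonomy (fun a => W (Sum.inl a)) (lat k).1 (lat k).2.1.1 (lat k).2.1.2),
      hCφ' (plaquetteHolonomy (fun a => W (Sum.inr a)) (lat k).1 (lat k).2.1.1 (lat k).2.1.2)])
  have hΔb : ∀ W, |(X W - X' W) * (Y W - Y' W)| ≤ σ * σ := fun W => by
    rw [abs_mul]
    exact mul_le_mul ((abs_sub _ _).trans (by rw [hσ]; linarith [hXb W, hX'b W]))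
      ((abs_sub _ _).trans (by rw [hσ]; linarith [hYb W, hY'b W])) (abs_nonneg _) hσ0
  have hI : ∀ {F : (Edge 4 L ⊕ Edge 4 L → G) → ℝ} {C : ℝ}, Measurable F → (∀ W, |F W| ≤ C) → Integrable F μ₂ :=
    fun hF hb => Integrable.of_bound hF.aestronglyMeasurable _ (Eventually.of_forall fun W => by
      rw [Real.norm_eq_abs]; exact hb W)
  ------------------------------------------------------------------ geometry of the laterals (as in part 6)
  set bottom : Fin 4 → Edge 4 L :=
    ![((0 : Site 4 L), (1 : Fin 4)), ((0 : Site 4 L).shift 2, (1 : Fin 4)), ((0 : Site 4 L), (2 : Fin 4)),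
      ((0 : Site 4 L).shift 1, (2 : Fin 4))] with hbottom
  have h1 : (1 : ZMod L) ≠ 0 := one_ne_zero
  have hs0 : ∀ k : Fin 4, (0 : Site 4 L).shift k ≠ 0 := fun k h => by
    have := congrFun h k; simp [shift_apply, h1] at this
  have hs0' : ∀ k : Fin 4, (0 : Site 4 L) ≠ (0 : Site 4 L).shift k := fun k h => hs0 k h.symm
  have hss : ∀ a b : Fin 4, a ≠ b → (0 : Site 4 L).shift a ≠ (0 : Site 4 L).shift b := fun a b hab h => by
    have := congrFun h a; simp [shift_apply, hab, h1] at this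
  have hss2 : ∀ a b c : Fin 4, c ≠ a → c ≠ b → ((0 : Site 4 L).shift a).shift b ≠ (0 : Site 4 L).shift c :=
    fun a b c hca hcb h => by have := congrFun h c; simp [shift_apply, hca, hcb] at this
  have hss2' : ∀ a b c : Fin 4, c ≠ a → c ≠ b → (0 : Site 4 L).shift c ≠ ((0 : Site 4 L).shift a).shift b :=
    fun a b c hca hcb h => hss2 a b c hca hcb h.symm
  have hss20' : ∀ a b : Fin 4, (0 : Site 4 L) ≠ ((0 : Site 4 L).shift a).shift b := fun a b h => by
    have := congrFun h.symm a; by_cases hab : a = b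
    · subst hab; simp [shift_apply] at this
      exact Literature.MathematicalPhysics.QuantumLattice.zmod_one_add_one_ne_zero_of_three_le hL this
    · simp [shift_apply, hab, h1] at this
  have hssb : ∀ a c : Fin 4, (0 : Site 4 L).shift c ≠ ((0 : Site 4 L).shift a).shift c := fun a c h => by
    have := congrFun h a
    by_cases hca : c = a
    · subst hca; simp [shift_apply, h1] at this
    · simp [shift_apply, Ne.symm hca] at this
  have hbP0 : ∀ k, bottom k ∈ ({((0 : Site 4 L), (1 : Fin 4)), ((0 : Site 4 L).shift 1, (2 : Fin 4)),
      ((0 : Site 4 L).shift 2, (1 : Fin 4)), ((0 : Site 4 L), (2 : Fin 4))} : Finset (Edge 4 L)) := by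
    intro k; fin_cases k <;> simp [hbottom]
  have hbP1 : ∀ k, bottom k ∉ ({(((0 : Site 4 L).shift 0), (1 : Fin 4)), (((0 : Site 4 L).shift 0).shift 1, (2 : Fin 4)),
      (((0 : Site 4 L).shift 0).shift 2, (1 : Fin 4)), (((0 : Site 4 L).shift 0), (2 : Fin 4))} : Finset (Edge 4 L)) := by
    intro k; fin_cases k <;> simp [hbottom, hs0', hss2', hss, hss20', hssb]
  have hblat : ∀ k k' : Fin 4, k ≠ k' → bottom k ∉ ({((lat k').1, (lat k').2.1.1),
      ((lat k').1.shift (lat k').2.1.1, (lat k').2.1.2), ((lat k').1.shift (lat k').2.1.2, (lat k').2.1.1),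
      ((lat k').1, (lat k').2.1.2)} : Finset (Edge 4 L)) := by
    intro k k' hkk'
    fin_cases k <;> fin_cases k' <;> first | exact absurd rfl hkk' | simp [hbottom, hlat, hs0, hs0', hss, hss2', hss20']
  have h12 : (1 : Fin 4) ≠ 2 := by decide
  ------------------------------------------------------------------ behaviour under single-bond updates
  have hX_r : ∀ W e g, X (update W (Sum.inr e) g) = X W := fun W e g => by simp only [hX, comp_inl_update_inr]
  have hX'_l : ∀ W e g, X' (update W (Sum.inl e) g) = X' W := fun W e g => by simp only [hX', comp_inr_update_inl]
  have hY_r : ∀ W e g, Y (update W (Sum.inr e) g) = Y W := fun W e g => by simp only [hY, comp_inl_update_inr]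
  have hY'_l : ∀ W e g, Y' (update W (Sum.inl e) g) = Y' W := fun W e g => by simp only [hY', comp_inr_update_inl]
  have hY_l : ∀ W k g, Y (update W (Sum.inl (bottom k)) g) = Y W := fun W k g => by
    simp only [hY, comp_inl_update_inl, plaquetteHolonomy_update_of_not_mem (hbP1 k)]
  have hY'_r : ∀ W k g, Y' (update W (Sum.inr (bottom k)) g) = Y' W := fun W k g => by
    simp only [hY', comp_inr_update_inr, plaquetteHolonomy_update_of_not_mem (hbP1 k)]
  have ht_r : ∀ k W e g, t k (update W (Sum.inr e) g) = t k W := fun k W e g => by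
    simp only [ht, comp_inl_update_inr]
  have ht'_l : ∀ k W e g, t' k (update W (Sum.inl e) g) = t' k W := fun k W e g => by
    simp only [ht', comp_inr_update_inl]
  have ht_l : ∀ k k' W g, k ≠ k' → t k' (update W (Sum.inl (bottom k)) g) = t k' W := fun k k' W g hkk' => by
    simp only [ht, comp_inl_update_inl, plaquetteHolonomy_update_of_not_mem (hblat k k' hkk')]
  have ht'_r : ∀ k k' W g, k ≠ k' → t' k' (update W (Sum.inr (bottom k)) g) = t' k' W := fun k k' W g hkk' => by
    simp only [ht', comp_inr_update_inr, plaquetteHolonomy_update_of_not_mem (hblat k k' hkk')]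
  ------------------------------------------------------------------ the coupling window
  refine ⟨3 * (32 * σ ^ 7) + 16 * |κ₀| * (2 * |J|), min 1 (min (1 / (σ + 1)) (1 / (8 * |κ₀| + 1))),
    by positivity, fun b hb => ?_⟩
  have hb1 : |b| ≤ 1 := hb.trans (min_le_left _ _)
  have hbσ : |b| * σ ≤ 1 := by
    have h := hb.trans ((min_le_right _ _).trans (min_le_left _ _))
    rw [le_div_iff₀ (by positivity)] at h
    nlinarith [abs_nonneg b]
  have hbκ : 8 * |b| * |κ₀| ≤ 1 := by
    have h := hb.trans ((min_le_right _ _).trans (min_le_right _ _))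
    rw [le_div_iff₀ (by positivity)] at h
    nlinarith [abs_nonneg b, abs_nonneg κ₀]
  ------------------------------------------------------------------ (L1) rewriting the Mayer weights
  set α : ℝ := Real.exp (-(2 * b * κ₀)) with hα
  set u : Fin 4 → (Edge 4 L ⊕ Edge 4 L → G) → ℝ := fun k W => Real.exp (b * (t k W + t' k W)) - 1 with hu
  have hum : ∀ k, Measurable (u k) := fun k => ((((htm k).add (ht'm k)).const_mul b).exp).sub measurable_const
  have hL1 : ∀ k W, Real.exp (-(b * dTerm ρ (lat k) W)) - 1 = α * u k W + (α - 1) := by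
    intro k W
    have hd : dTerm ρ (lat k) W = 2 * κ₀ - (t k W + t' k W) := by
      simp only [dTerm, plaquetteCost, hcost, ht, ht']; ring
    rw [hd, show -(b * (2 * κ₀ - (t k W + t' k W))) = -(2 * b * κ₀) + b * (t k W + t' k W) by ring, Real.exp_add]
    simp only [hα, hu]; ring
  -- behaviour of `u k` under bottom-bond updates
  have hu_l : ∀ k k' W g, k ≠ k' → u k' (update W (Sum.inl (bottom k)) g) = u k' W := fun k k' W g hkk' => by
    simp only [hu, ht_l k k' W g hkk', ht'_l]
  have hu_r : ∀ k k' W g, k ≠ k' → u k' (update W (Sum.inr (bottom k)) g) = u k' W := fun k k' W g hkk' => by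
    simp only [hu, ht_r, ht'_r k k' W g hkk']
  ------------------------------------------------------------------ (L2) only the full product survives
  set V : Finset (Fin 4) → (Edge 4 L ⊕ Edge 4 L → G) → ℝ := fun A W =>
    (∏ k ∈ A, (α * u k W)) * ∏ k ∈ Finset.univ \ A, (α - 1) with hV
  have hVm : ∀ A, Measurable (V A) := fun A =>
    (Finset.measurable_prod _ fun k _ => (hum k).const_mul α).mul measurable_const
  obtain ⟨CV, hCV⟩ : ∃ CV : ℝ, ∀ A W, |V A W| ≤ CV := by
    have hub : ∀ k W, |u k W| ≤ 2 := fun k W => by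
      have hx : |b * (t k W + t' k W)| ≤ 1 := by
        rw [abs_mul]; exact (mul_le_mul_of_nonneg_left (hsb k W) (abs_nonneg b)).trans hbσ
      exact (Real.abs_exp_sub_one_le hx).trans (by linarith)
    refine ⟨(|α| * 2 + 1) ^ 4 * (|α - 1| + 1) ^ 4, fun A W => ?_⟩
    simp only [hV, abs_mul, Finset.abs_prod]
    refine mul_le_mul ?_ ?_ (Finset.prod_nonneg fun _ _ => abs_nonneg _) (by positivity)
    · calc ∏ k ∈ A, |α| * |u k W| ≤ ∏ _k ∈ A, (|α| * 2 + 1) := Finset.prod_le_prod (fun _ _ => by positivity)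
            fun k _ => by nlinarith [hub k W, abs_nonneg α, abs_nonneg (u k W)]
        _ = (|α| * 2 + 1) ^ A.card := Finset.prod_const _
        _ ≤ (|α| * 2 + 1) ^ 4 := pow_le_pow_right₀ (by nlinarith [abs_nonneg α]) (by simpa using Finset.card_le_univ A)
    · calc ∏ _k ∈ Finset.univ \ A, |α - 1| ≤ ∏ _k ∈ Finset.univ \ A, (|α - 1| + 1) :=
            Finset.prod_le_prod (fun _ _ => abs_nonneg _) fun _ _ => by linarith
        _ = (|α - 1| + 1) ^ (Finset.univ \ A).card := Finset.prod_const _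
        _ ≤ (|α - 1| + 1) ^ 4 := pow_le_pow_right₀ (by linarith [abs_nonneg (α - 1)])
            (by simpa using Finset.card_le_univ (Finset.univ \ A))
  have hV_l : ∀ A k W g, k ∉ A → V A (update W (Sum.inl (bottom k)) g) = V A W := by
    intro A k W g hk
    simp only [hV]
    rw [Finset.prod_congr rfl fun k' hk' => by rw [hu_l k k' W g fun h => hk (h ▸ hk')]]
  have hV_r : ∀ A k W g, k ∉ A → V A (update W (Sum.inr (bottom k)) g) = V A W := by
    intro A k W g hk
    simp only [hV]
    rw [Finset.prod_congr rfl fun k' hk' => by rw [hu_r k k' W g fun h => hk (h ▸ hk')]]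
  have hvan : ∀ A, A ≠ Finset.univ → ∫ W, (X W - X' W) * (Y W - Y' W) * V A W ∂μ₂ = 0 := by
    intro A hA
    obtain ⟨k₀, hk₀⟩ : ∃ k, k ∉ A := by
      by_contra h; push Not at h; exact hA (Finset.eq_univ_of_forall h)
    have hRm : Measurable fun W => (Y W - Y' W) * V A W := (hYm.sub hY'm).mul (hVm A)
    have hRb : ∀ W, |(Y W - Y' W) * V A W| ≤ σ * CV := fun W => by
      rw [abs_mul]
      exact mul_le_mul ((abs_sub _ _).trans (by rw [hσ]; linarith [hYb W, hY'b W])) (hCV A W) (abs_nonneg _) hσ0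
    have hsplit : ∀ W, (X W - X' W) * (Y W - Y' W) * V A W =
        X W * ((Y W - Y' W) * V A W) - X' W * ((Y W - Y' W) * V A W) := fun W => by ring
    simp_rw [hsplit]
    have i1 : Integrable (fun W => X W * ((Y W - Y' W) * V A W)) μ₂ :=
      hI (hXm.mul hRm) (fun W => by rw [abs_mul]; exact mul_le_mul (hXb W) (hRb W) (abs_nonneg _) hC0)
    have i2 : Integrable (fun W => X' W * ((Y W - Y' W) * V A W)) μ₂ :=
      hI (hX'm.mul hRm) (fun W => by rw [abs_mul]; exact mul_le_mul (hX'b W) (hRb W) (abs_nonneg _) hC0)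
    rw [integral_sub i1 i2]
    simp only [hX, hX']
    rw [integral_peel_inl 0 h12 (hbP0 k₀) hφc (R := fun W => (Y W - Y' W) * V A W) hRm hRb
        (fun W g => by rw [hY_l, hY'_l, hV_l A k₀ W g hk₀]),
      integral_peel_inr 0 h12 (hbP0 k₀) hφc (R := fun W => (Y W - Y' W) * V A W) hRm hRb
        (fun W g => by rw [hY_r, hY'_r, hV_r A k₀ W g hk₀]), hφ0]
    ring
  have hT : ∫ W, (X W - X' W) * (Y W - Y' W) * ∏ k, (Real.exp (-(b * dTerm ρ (lat k) W)) - 1) ∂μ₂ =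
      α ^ 4 * ∫ W, (X W - X' W) * (Y W - Y' W) * ∏ k, u k W ∂μ₂ := by
    have hexp : ∀ W, (X W - X' W) * (Y W - Y' W) * ∏ k, (Real.exp (-(b * dTerm ρ (lat k) W)) - 1) =
        ∑ A ∈ (Finset.univ : Finset (Fin 4)).powerset, (X W - X' W) * (Y W - Y' W) * V A W := by
      intro W
      simp only [hL1]
      rw [Finset.prod_add, Finset.mul_sum]
    simp_rw [hexp]
    have iA : ∀ A, Integrable (fun W => (X W - X' W) * (Y W - Y' W) * V A W) μ₂ := fun A =>
      hI (((hXm.sub hX'm).mul (hYm.sub hY'm)).mul (hVm A)) fun W => by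
        rw [abs_mul]; exact mul_le_mul (hΔb W) (hCV A W) (abs_nonneg _) (by positivity)
    rw [integral_finsetSum _ fun A _ => iA A]
    rw [Finset.sum_eq_single_of_mem Finset.univ (Finset.mem_powerset_self _) fun A _ hA => hvan A hA]
    have hVu : ∀ W, V Finset.univ W = α ^ 4 * ∏ k, u k W := fun W => by
      simp only [hV, Finset.sdiff_self, Finset.prod_mul_distrib, Finset.prod_const, Finset.card_univ,
        Fintype.card_fin, Finset.card_empty, pow_zero, mul_one]
    simp_rw [hVu]
    rw [← integral_const_mul]
    exact integral_congr_ae (Eventually.of_forall fun W => by ring)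
  ------------------------------------------------------------------ (L3) the product to order `b⁴`
  have hL3 : ∀ W, |∏ k, u k W - b ^ 4 * ∏ k, (t k W + t' k W)| ≤ 32 * σ ^ 5 * |b| ^ 5 := by
    intro W
    have hrw : b ^ 4 * ∏ k, (t k W + t' k W) = ∏ k, (b * (t k W + t' k W)) := by
      rw [Finset.prod_mul_distrib, Finset.prod_const, Finset.card_univ, Fintype.card_fin]
    rw [hrw]
    have hx : ∀ k, |b * (t k W + t' k W)| ≤ |b| * σ := fun k => by
      rw [abs_mul]; exact mul_le_mul_of_nonneg_left (hsb k W) (abs_nonneg b)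
    have hx1 : ∀ k, |b * (t k W + t' k W)| ≤ 1 := fun k => (hx k).trans hbσ
    refine (abs_prod_four_sub_prod_le (A := 2 * (|b| * σ)) (δ := (|b| * σ) ^ 2) (by positivity)
      (fun k => (Real.abs_exp_sub_one_le (hx1 k)).trans (by linarith [hx k]))
      (fun k => (hx k).trans (by nlinarith [abs_nonneg b])) (fun k => ?_)).trans (le_of_eq (by ring))
    calc |Real.exp (b * (t k W + t' k W)) - 1 - b * (t k W + t' k W)| ≤ (b * (t k W + t' k W)) ^ 2 :=
          Real.abs_exp_sub_one_sub_id_le (hx1 k)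
      _ = |b * (t k W + t' k W)| ^ 2 := (sq_abs _).symm
      _ ≤ (|b| * σ) ^ 2 := pow_le_pow_left₀ (abs_nonneg _) (hx k) 2
  ------------------------------------------------------------------ (L4) the leading coefficient
  have hJ2 : ∫ W, (X W - X' W) * (Y W - Y' W) * ∏ k, (t k W + t' k W) ∂μ₂ = 2 * J :=
    lateral_leading_coeff hL hφc hφz hφs hφ0
  have hprod_m : Measurable fun W => (X W - X' W) * (Y W - Y' W) * ∏ k, u k W :=
    ((hXm.sub hX'm).mul (hYm.sub hY'm)).mul (Finset.measurable_prod _ fun k _ => hum k)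
  have hub4 : ∀ W, |∏ k, u k W| ≤ 2 ^ 4 := fun W => by
    rw [Finset.abs_prod]
    calc ∏ k, |u k W| ≤ ∏ _k : Fin 4, (2 : ℝ) := Finset.prod_le_prod (fun _ _ => abs_nonneg _) fun k _ => by
            have hx : |b * (t k W + t' k W)| ≤ 1 := by
              rw [abs_mul]; exact (mul_le_mul_of_nonneg_left (hsb k W) (abs_nonneg b)).trans hbσ
            exact (Real.abs_exp_sub_one_le hx).trans (by linarith)
      _ = 2 ^ 4 := by simp
  have hsb4 : ∀ W, |∏ k, (t k W + t' k W)| ≤ σ ^ 4 := fun W => by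
    rw [Finset.abs_prod]
    calc ∏ k, |t k W + t' k W| ≤ ∏ _k : Fin 4, σ := Finset.prod_le_prod (fun _ _ => abs_nonneg _) fun k _ => hsb k W
      _ = σ ^ 4 := by simp
  have hL4 : |(∫ W, (X W - X' W) * (Y W - Y' W) * ∏ k, u k W ∂μ₂) - 2 * J * b ^ 4| ≤ σ * σ * (32 * σ ^ 5 * |b| ^ 5) := by
    rw [show 2 * J * b ^ 4 = ∫ W, (X W - X' W) * (Y W - Y' W) * (b ^ 4 * ∏ k, (t k W + t' k W)) ∂μ₂ by
      rw [show (fun W => (X W - X' W) * (Y W - Y' W) * (b ^ 4 * ∏ k, (t k W + t' k W))) =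
        fun W => b ^ 4 * ((X W - X' W) * (Y W - Y' W) * ∏ k, (t k W + t' k W)) from funext fun W => by ring,
        integral_const_mul, hJ2]; ring]
    have i1 : Integrable (fun W => (X W - X' W) * (Y W - Y' W) * ∏ k, u k W) μ₂ :=
      hI hprod_m fun W => by rw [abs_mul]; exact mul_le_mul (hΔb W) (hub4 W) (abs_nonneg _) (by positivity)
    have hm2 : Measurable fun W => (X W - X' W) * (Y W - Y' W) * (b ^ 4 * ∏ k, (t k W + t' k W)) :=
      ((hXm.sub hX'm).mul (hYm.sub hY'm)).mul ((Finset.measurable_prod _ fun k _ => (htm k).add (ht'm k)).const_mul _)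
    have i2 : Integrable (fun W => (X W - X' W) * (Y W - Y' W) * (b ^ 4 * ∏ k, (t k W + t' k W))) μ₂ :=
      hI (C := σ * σ * (|b| ^ 4 * σ ^ 4)) hm2 fun W => by
        rw [abs_mul]
        refine mul_le_mul (hΔb W) ?_ (abs_nonneg _) (by positivity)
        rw [abs_mul, abs_pow]
        exact mul_le_mul_of_nonneg_left (hsb4 W) (by positivity)
    rw [← integral_sub i1 i2]
    refine (abs_integral_le_integral_abs).trans ?_
    calc ∫ W, |(X W - X' W) * (Y W - Y' W) * ∏ k, u k W - (X W - X' W) * (Y W - Y' W) * (b ^ 4 * ∏ k, (t k W + t' k W))| ∂μ₂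
        ≤ ∫ _W, σ * σ * (32 * σ ^ 5 * |b| ^ 5) ∂μ₂ := by
          refine integral_mono_of_nonneg (Eventually.of_forall fun _ => abs_nonneg _) (integrable_const _)
            (Eventually.of_forall fun W => ?_)
          dsimp only
          rw [← mul_sub, abs_mul]
          exact mul_le_mul (hΔb W) (hL3 W) (abs_nonneg _) (by positivity)
      _ = σ * σ * (32 * σ ^ 5 * |b| ^ 5) := by simp
  ------------------------------------------------------------------ (L5) assembly
  have hα4 : α ^ 4 = Real.exp (-(8 * b * κ₀)) := by rw [hα, ← Real.exp_nat_mul]; ring_nf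
  have hx8 : |-(8 * b * κ₀)| ≤ 1 := by rw [abs_neg, abs_mul, abs_mul]; norm_num; linarith [hbκ]
  have hα4b : α ^ 4 ≤ 3 := by
    rw [hα4]
    calc Real.exp (-(8 * b * κ₀)) ≤ Real.exp 1 := Real.exp_le_exp.2 ((le_abs_self _).trans hx8)
      _ ≤ 3 := by have := Real.exp_one_lt_d9; linarith
  have hα41 : |α ^ 4 - 1| ≤ 16 * |b| * |κ₀| := by
    rw [hα4]
    calc |Real.exp (-(8 * b * κ₀)) - 1| ≤ 2 * |-(8 * b * κ₀)| := Real.abs_exp_sub_one_le hx8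
      _ = 16 * |b| * |κ₀| := by rw [abs_neg, abs_mul, abs_mul]; norm_num; ring
  change |(∫ W, (X W - X' W) * (Y W - Y' W) * ∏ k, (Real.exp (-(b * dTerm ρ (lat k) W)) - 1) ∂μ₂) - 2 * J * b ^ 4|
    ≤ (3 * (32 * σ ^ 7) + 16 * |κ₀| * (2 * |J|)) * |b| ^ 5
  rw [hT]
  have hsplit : α ^ 4 * (∫ W, (X W - X' W) * (Y W - Y' W) * ∏ k, u k W ∂μ₂) - 2 * J * b ^ 4 =
      α ^ 4 * ((∫ W, (X W - X' W) * (Y W - Y' W) * ∏ k, u k W ∂μ₂) - 2 * J * b ^ 4) + (α ^ 4 - 1) * (2 * J * b ^ 4) := by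
    ring
  rw [hsplit]
  have hα0 : 0 ≤ α ^ 4 := by positivity
  calc |α ^ 4 * ((∫ W, (X W - X' W) * (Y W - Y' W) * ∏ k, u k W ∂μ₂) - 2 * J * b ^ 4) + (α ^ 4 - 1) * (2 * J * b ^ 4)|
      ≤ α ^ 4 * (σ * σ * (32 * σ ^ 5 * |b| ^ 5)) + 16 * |b| * |κ₀| * (2 * |J| * |b| ^ 4) := by
        refine (abs_add_le _ _).trans (add_le_add ?_ ?_)
        · rw [abs_mul, abs_of_nonneg hα0]; exact mul_le_mul_of_nonneg_left hL4 hα0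
        · rw [abs_mul]
          refine mul_le_mul hα41 (le_of_eq (by rw [abs_mul, abs_mul, abs_pow]; norm_num)) (abs_nonneg _)
            (by positivity)
    _ = α ^ 4 * (32 * σ ^ 7 * |b| ^ 5) + 16 * |κ₀| * (2 * |J|) * |b| ^ 5 := by ring
    _ ≤ 3 * (32 * σ ^ 7 * |b| ^ 5) + 16 * |κ₀| * (2 * |J|) * |b| ^ 5 :=
        add_le_add (mul_le_mul_of_nonneg_right hα4b (by positivity)) le_rfl
    _ = (3 * (32 * σ ^ 7) + 16 * |κ₀| * (2 * |J|)) * |b| ^ 5 := by ring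

end Summit.QuantumFields.YangMills.Cruxes.IR.SCFloor

end
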